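import Summits.Ventures.PercRepro.GZ24Final
import Summits.Ventures.PercRepro.OrbitClasses

/-!
# PercRepro — the class-level swap principle, and ORBIT-2 with constant 1 on every interval (typer-2, gen 6)

mine-4's remark (bus 10:34:29Z): a STATIC SWAP (p5's `swapPair`, GZ24 Lemma 4.2 in finite form) exchanges the
states of some edges between the two configurations of a pair, so it preserves the meet `ω ⊓ ω'` and the join
`ω ⊔ ω'` — it maps every ANTIPODAL pair of an interval `[v, u]` of the cube to an antipodal pair of the same
interval. Hence a swap-bijection proof of a law-level inequality `P(X) P(Y) ≤ …` proves the CLASS-LEVEL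
antipodal-count inequality on every interval for free.

* `antipodalPairs u v` — the ordered antipodal pairs of the interval: `(ω, ω')` with `ω ⊓ ω' = v`, `ω ⊔ ω' = u`;
  `swapPair_mem_antipodalPairs`, **`sum_antipodalPairs_swapPair`** — a recoverable swap permutes them
  (`Finset.sum_nbij'` with the global bijection `swapPair_bijective`).
* **`gz24_final_classes`** — Gladkov–Zimin eq. (final) on every interval: with `P = antipodalPairs u v`,
  `#{(ω, ω') ∈ P : ω ∈ a|b ∩ a|c, ω' ∈ ab ∪ ac} ≤ #{ω' : ab|c} + #{ω' : ac|b} + #{ω : bc|a}` (counts over `P`) —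
  p5's pointwise `indicator_bound` summed over the antipodal pairs instead of the weighted pairs.
* **`orbit2_const_one`** — **ORBIT-2 with constant 1** in the vocabulary of `Orbit.lean`: for every finite
  multigraph, every three marks and every interval `[I, I ⊔ D]` with `I ⊓ D = ⊥`,
  `a₁₃ ≤ c₂`, i.e. `antipodalCount ![a, b, c] I D 1 3 ≤ intervalCount ![a, b, c] I D 2`; **`Orbit2ConstOne`** /
  **`Orbit2ConstOne_holds`** name it. The row C-021 claims constant 2 (`Orbit2`, `C021`); constant 1 is now a
  theorem on every class (the class-level twin of p5's `c021_const_one`).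
-/

namespace PercRepro

open Finset Classical

/-! ### Antipodal pairs of an interval and the swap -/

section Pairs

variable {E : Type*} [Fintype E] [DecidableEq E]

/-- The ordered antipodal pairs of the interval `[v, u]`: `(ω, ω')` with `ω ⊓ ω' = v` and `ω ⊔ ω' = u`. -/
def antipodalPairs (u v : Config E) : Finset (Config E × Config E) :=
  univ.filter fun x => x.1 ⊓ x.2 = v ∧ x.1 ⊔ x.2 = u

/-- Membership in the antipodal pairs. -/
theorem mem_antipodalPairs {u v : Config E} {x : Config E × Config E} :
    x ∈ antipodalPairs u v ↔ x.1 ⊓ x.2 = v ∧ x.1 ⊔ x.2 = u := by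
  simp [antipodalPairs]

omit [Fintype E] [DecidableEq E] in
/-- A swap preserves the meet of the pair. -/
theorem mix_compl_inf_mix (S : Set E) (ω ω' : Config E) : mix Sᶜ ω ω' ⊓ mix S ω ω' = ω ⊓ ω' := by
  funext e
  by_cases he : e ∈ S
  · simp only [Pi.inf_apply, mix_compl_apply_of_mem he, mix_apply_of_mem he, inf_comm]
  · simp only [Pi.inf_apply, mix_compl_apply_of_notMem he, mix_apply_of_notMem he]

omit [Fintype E] [DecidableEq E] in
/-- A swap preserves the join of the pair. -/
theorem mix_compl_sup_mix (S : Set E) (ω ω' : Config E) : mix Sᶜ ω ω' ⊔ mix S ω ω' = ω ⊔ ω' := by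
  funext e
  by_cases he : e ∈ S
  · simp only [Pi.sup_apply, mix_compl_apply_of_mem he, mix_apply_of_mem he, sup_comm]
  · simp only [Pi.sup_apply, mix_compl_apply_of_notMem he, mix_apply_of_notMem he]

omit [Fintype E] [DecidableEq E] in
/-- The swapped pair has the meet of the pair. -/
theorem swapPair_inf (S : Config E → Config E → Set E) (x : Config E × Config E) :
    (swapPair S x).1 ⊓ (swapPair S x).2 = x.1 ⊓ x.2 :=
  mix_compl_inf_mix _ _ _

omit [Fintype E] [DecidableEq E] in
/-- The swapped pair has the join of the pair. -/
theorem swapPair_sup (S : Config E → Config E → Set E) (x : Config E × Config E) :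
    (swapPair S x).1 ⊔ (swapPair S x).2 = x.1 ⊔ x.2 :=
  mix_compl_sup_mix _ _ _

/-- **A swap maps antipodal pairs of an interval to antipodal pairs of the same interval.** -/
theorem swapPair_mem_antipodalPairs (S : Config E → Config E → Set E) {u v : Config E}
    {x : Config E × Config E} (hx : x ∈ antipodalPairs u v) : swapPair S x ∈ antipodalPairs u v := by
  rw [mem_antipodalPairs] at hx ⊢
  rw [swapPair_inf, swapPair_sup]
  exact hx

/-- **The class-level swap lemma**: a recoverable swap permutes the antipodal pairs of every interval, so
any sum over them is invariant under the swap. -/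
theorem sum_antipodalPairs_swapPair {S : Config E → Config E → Set E} (hS : Recoverable S)
    (F : Config E → Config E → ℝ) (u v : Config E) :
    ∑ x ∈ antipodalPairs u v, F (swapPair S x).1 (swapPair S x).2 =
      ∑ x ∈ antipodalPairs u v, F x.1 x.2 := by
  let e : Config E × Config E ≃ Config E × Config E :=
    Equiv.ofBijective (swapPair S) (swapPair_bijective hS)
  have he : ∀ x, e x = swapPair S x := fun x => rfl
  refine Finset.sum_nbij' (swapPair S) e.symm (fun x hx => swapPair_mem_antipodalPairs S hx)
    (fun y hy => ?_) (fun x _ => ?_) (fun y _ => ?_) (fun x _ => rfl)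
  · rw [mem_antipodalPairs] at hy ⊢
    have h1 := swapPair_inf S (e.symm y)
    have h2 := swapPair_sup S (e.symm y)
    rw [← he, Equiv.apply_symm_apply] at h1 h2
    exact ⟨h1 ▸ hy.1, h2 ▸ hy.2⟩
  · rw [← he]
    exact e.symm_apply_apply x
  · rw [← he]
    exact e.apply_symm_apply y

/-- The number of antipodal pairs `(ω, ω')` of the interval `[v, u]` with `ω ∈ X` and `ω' ∈ Y` (classical
decidability, fixed once here; the lemmas below are generic in `X`, `Y`, so no instance is ever re-synthesised). -/
noncomputable def pairCountIn (u v : Config E) (X Y : Set (Config E)) : ℕ :=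
  ((antipodalPairs u v).filter fun x => x.1 ∈ X ∧ x.2 ∈ Y).card

/-- The number of antipodal pairs `(ω, ω')` of `[v, u]` with `ω ∈ X`. -/
noncomputable def pairCountFst (u v : Config E) (X : Set (Config E)) : ℕ :=
  ((antipodalPairs u v).filter fun x => x.1 ∈ X).card

/-- The number of antipodal pairs `(ω, ω')` of `[v, u]` with `ω' ∈ Y`. -/
noncomputable def pairCountSnd (u v : Config E) (Y : Set (Config E)) : ℕ :=
  ((antipodalPairs u v).filter fun x => x.2 ∈ Y).card

/-- The sum of a product of indicators over the antipodal pairs is `pairCountIn`. -/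
theorem sum_antipodalPairs_indicator_mul (u v : Config E) (X Y : Set (Config E)) :
    ∑ x ∈ antipodalPairs u v, X.indicator (1 : Config E → ℝ) x.1 * Y.indicator 1 x.2 =
      pairCountIn u v X Y := by
  unfold pairCountIn
  rw [Finset.card_filter]
  push_cast
  refine Finset.sum_congr rfl fun x _ => ?_
  by_cases h1 : x.1 ∈ X <;> by_cases h2 : x.2 ∈ Y <;> simp [h1, h2]

/-- The sum of an indicator of the first coordinate is `pairCountFst`. -/
theorem sum_antipodalPairs_indicator_fst (u v : Config E) (X : Set (Config E)) :
    ∑ x ∈ antipodalPairs u v, X.indicator (1 : Config E → ℝ) x.1 = pairCountFst u v X := by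
  unfold pairCountFst
  rw [Finset.card_filter]
  push_cast
  refine Finset.sum_congr rfl fun x _ => ?_
  by_cases h : x.1 ∈ X <;> simp [h]

/-- The sum of an indicator of the second coordinate is `pairCountSnd`. -/
theorem sum_antipodalPairs_indicator_snd (u v : Config E) (Y : Set (Config E)) :
    ∑ x ∈ antipodalPairs u v, Y.indicator (1 : Config E → ℝ) x.2 = pairCountSnd u v Y := by
  unfold pairCountSnd
  rw [Finset.card_filter]
  push_cast
  refine Finset.sum_congr rfl fun x _ => ?_
  by_cases h : x.2 ∈ Y <;> simp [h]

/-- A finset injecting into the antipodal pairs in `X × Y` is at most `pairCountIn`. -/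
theorem card_le_pairCountIn {ι : Type*} (s : Finset ι) (f : ι → Config E × Config E)
    (u v : Config E) (X Y : Set (Config E))
    (hf : ∀ A ∈ s, f A ∈ antipodalPairs u v ∧ (f A).1 ∈ X ∧ (f A).2 ∈ Y)
    (hinj : Set.InjOn f s) : s.card ≤ pairCountIn u v X Y := by
  unfold pairCountIn
  refine Finset.card_le_card_of_injOn f (fun A hA => ?_) hinj
  rw [Finset.mem_coe, Finset.mem_filter]
  exact hf A (Finset.mem_coe.mp hA)

end Pairs

end PercRepro
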